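import Summits.NavierStokesRegularity.FluidComputer.CKNFace
import Summits.NavierStokesRegularity.FluidComputer.SerrinFace
import Summits.NavierStokesRegularity.FluidComputer.GeometricFace
import HarnessLib

/-!
# Fluid computer — the ANATOMY OF A REALISED BLOW-UP, assembled (L30–L34): Serrin, Beale–Kato–Majda,
# Constantin–Fefferman, the focus, and the CKN floor at the focus

HONEST FRAMING (cell `pub-fluidc`, verbatim): *low prior, high value-of-information experiment on Tao's
machine paradigm; NOT a claim that NS blows up.* Theorem side of the cell; nothing here is evidence of blow-up.
One statement for the paper's §4, companion of `CascadeNecessities.cascade_necessities` (flux face),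
`LerayTimeFace.time_face` (time face) and `CriticalFace.critical_face` (critical face): the classical blow-up
criteria of the literature READ AS NECESSITIES of the dictionary's class, with every class hypothesis discharged.

* `blowup_anatomy` — there is ONE absolute `ε > 0` such that for every `ν > 0`, `T > 0` and every maximal smooth
  solution `(u, p)` of the unforced Navier–Stokes system on `ℝ³ × [0, T)` which is Leray–Hopf from `u 0`:
  (S) on every terminal window `(t₀, T)`, `∫‖u(s)‖_∞² ds = ∞` (Prodi–Serrin, `SerrinFace`);
  (B) on every terminal window, `∫ sup_x‖curl u‖ dt = ∞` (Beale–Kato–Majda, `GeometricFace`, class discharged);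
  (CF) for all `Ω, ρ > 0` and `t₀ < T` the vorticity direction is not `ρ⁻¹`-coherent over `{‖ω‖ > Ω}` on `[t₀, T)`
  (Constantin–Fefferman, `GeometricFace`);
  (F) there is a FOCUS `x₀`: `u` is unbounded on every backward parabolic neighbourhood `(T − r², T) × B_r(x₀)`
  (`LocalisationFace.exists_singularPoint`), AND at that very point, for the viscosity-normalised solution
  `w = ν⁻¹u(ν⁻¹·)` and its Riesz pressure gauge, `ε ≤ cknC ρ + cknD ρ` at `(νT, x₀)` for EVERY scale
  `0 < ρ < √(νT)` (Caffarelli–Kohn–Nirenberg, `CKNFace.ckn_concentration_at`).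

Words for the writer: a realised finite-energy blow-up has divergent Serrin and BKM integrals on every terminal
window, vortex lines that kink at every amplitude threshold and coherence length, and a spatial focus carrying an
`ε` of dimensionless space–time mass at every parabolic scale. HONEST SIZE NOTE: `ε` inexplicit; everything else
is a divergence / existence statement with no constant. Necessity only; nothing about sufficiency.
0 sorry; no new definitions, no named facts.

## References

* J. Serrin (1963), Thm. 6; G. Prodi (1959). [Prodi1959]
* J. T. Beale, T. Kato, A. Majda, Comm. Math. Phys. 94 (1984), Thm. 1. [BealeKatoMajda1984]
* P. Constantin, C. Fefferman, Indiana Univ. Math. J. 42 (1993), Theorem. [ConstantinFeffermanIndiana1993]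
* L. Caffarelli, R. Kohn, L. Nirenberg, Comm. Pure Appl. Math. 35 (1982), Prop. 1. [CKN1982]
* J. C. Robinson, J. L. Rodrigo, W. Sadowski, CUP 2016, Thm. 15.3. [RobinsonRodrigoSadowski2016]
-/

noncomputable section

open MeasureTheory Set Function Filter Topology Metric
open scoped ENNReal NNReal
open Literature.Analysis.FluidPDE Literature.Analysis.FunctionSpaces
open Summit.NavierStokesRegularity.FluidComputer.LocalisationFace
open Summit.NavierStokesRegularity.FluidComputer.CKNFace
open Summit.NavierStokesRegularity.FluidComputer.SerrinFace
open Summit.NavierStokesRegularity.FluidComputer.GeometricFace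

namespace Summit.NavierStokesRegularity.FluidComputer.BlowupAnatomy

/-- **THE ANATOMY OF A REALISED BLOW-UP (L30–L34 assembled).** There is an absolute `ε > 0` such that for every
`ν > 0`, `T > 0` and every maximal smooth solution `(u, p)` of the unforced Navier–Stokes system on `ℝ³ × [0, T)`
which is Leray–Hopf from `u 0`: (S) `∫⁻_{(t₀,T)} ‖u(s)‖_∞² ds = ∞` and (B) `∫⁻_{(t₀,T)} sup_x ‖curl u(t,x)‖ dt = ∞`
for every `t₀ ∈ [0, T)`; (CF) for all `Ω > 0`, `ρ > 0`, `t₀ ∈ [0, T)` the vorticity direction fails to be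
`ρ⁻¹`-Lipschitz (sine of the angle) over `{‖curl u‖ > Ω}` on `[t₀, T)`; (F) there is `x₀` with `u` unbounded on
every `(T − r², T) × B_r(x₀)` AND, at that `x₀`, the CKN floor `ε ≤ cknC ρ + cknD ρ` at `(νT, x₀)` for the
viscosity-normalised solution, at every scale `0 < ρ`, `ρ² < νT`.
[cite: Prodi1959] [cite: BealeKatoMajda1984, Theorem 1] [cite: ConstantinFeffermanIndiana1993, Theorem (§1)]
[cite: CKN1982, Prop. 1] [cite: RobinsonRodrigoSadowski2016, Thm. 15.3] -/
theorem blowup_anatomy :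
    ∃ ε : ℝ, 0 < ε ∧ ∀ (ν T : ℝ), 0 < ν → 0 < T →
      ∀ (u : ℝ → EuclideanSpace ℝ (Fin 3) → EuclideanSpace ℝ (Fin 3)) (p : ℝ → EuclideanSpace ℝ (Fin 3) → ℝ),
      IsMaximalSmoothSolution ν 0 u p T → IsLerayHopfOn T ν 0 (u 0) u →
      (∀ t₀ ∈ Ico 0 T, (∫⁻ s in Ioo t₀ T, eLpNorm (u s) ∞ volume ^ 2) = ∞ ∧
        (∫⁻ t in Ioo t₀ T, ⨆ x, ‖curl (u t) x‖ₑ) = ∞) ∧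
      (∀ (Ω ρ t₀ : ℝ), 0 < Ω → 0 < ρ → t₀ ∈ Ico 0 T →
        ¬ (∀ t ∈ Ico t₀ T, ∀ x y : EuclideanSpace ℝ (Fin 3), Ω < ‖curl (u t) x‖ → Ω < ‖curl (u t) y‖ →
          Real.sqrt (1 - inner ℝ (vorticityDirection (curl (u t)) x) (vorticityDirection (curl (u t)) y) ^ 2) ≤
            ‖x - y‖ / ρ)) ∧
      ∃ x₀ : EuclideanSpace ℝ (Fin 3),
        (∀ r : ℝ, 0 < r → ∀ M : ℝ, ∃ t ∈ Ioo (T - r ^ 2) T, 0 < t ∧ ∃ x ∈ ball x₀ r, M < ‖u t x‖) ∧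
        ∀ ρ : ℝ, 0 < ρ → ρ ^ 2 < T * ν →
          ENNReal.ofReal ε ≤
            cknC ρ ((T * ν : ℝ), x₀) (timeRescale ν⁻¹ ν⁻¹ u) +
            cknD ρ ((T * ν : ℝ), x₀) (fun s x => timeRescale ν⁻¹ (ν⁻¹ ^ 2) p s x -
              (timeRescale ν⁻¹ (ν⁻¹ ^ 2) p s 0 - normalisedPressure (timeRescale ν⁻¹ ν⁻¹ u s) 0)) := by
  obtain ⟨ε, hε, H⟩ := ckn_concentration_at
  refine ⟨ε, hε, fun ν T hν hT u p hmax hLH => ⟨fun t₀ ht₀ => ⟨?_, ?_⟩, fun Ω ρ t₀ hΩ hρ ht₀ => ?_, ?_⟩⟩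
  · exact lintegral_supNorm_sq_eq_top hν hT hmax hLH ht₀
  · exact GeometricFace.lintegral_iSup_curl_window_eq_top hν hT hmax hLH ht₀
  · exact vorticityDirection_not_coherent hν hT hmax hLH hΩ hρ ht₀
  · obtain ⟨x₀, hx₀⟩ := exists_singularPoint hν hT hmax hLH
    exact ⟨x₀, hx₀, fun ρ hρ hρT => H ν T hν hT u p hmax.1 hLH x₀ hx₀ ρ hρ hρT⟩

end Summit.NavierStokesRegularity.FluidComputer.BlowupAnatomy

end
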